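import Summits.Ventures.HodgeRepro2.T5CircleFourier

/-!
# T5CircleCharacterDetermines — the character determines a representation of the circle group

Support (seat p1, blind lane) for route/T5-N4-p5.md v10 (N4.3 = (R3), rows P2′ — «read off from the
character») and the last-column item of route/T5-SUPPORT-p1.md §S4.11 row 6 («the converse (equal
multiplicities ⇒ equivalent representations: the construction of the equivalence) — not
formalised»), for `K = Circle`: two continuous finite-dimensional representations of `Circle` with
the same character are equivalent — the equivalence is CONSTRUCTED from the integer weight
decompositions `V = ⨁_n V_n`, `V' = ⨁_n V'_n` (T5CircleWeightSpaces) by matching bases of the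
weight spaces of equal dimension (Mathlib `DirectSum.IsInternal.collectedBasis`, `Module.Basis.equiv`).

Main statements:
* `finrank_weightSpace_eq_of_character_eq` — equal characters give equal weight multiplicities
  (both are the same Fourier coefficient, T5CircleWeights on `haarCircle`);
* `exists_linearEquiv_of_character_eq` — an intertwining linear equivalence `e : V ≃ₗ[ℂ] V'`,
  `e (π z v) = π' z (e v)`;
* `exists_linearEquiv_iff_character_eq` — …and conversely (the trace is invariant under conjugation).

Honest scope: nothing about (N), U(1,1) or the infinite-dimensional π₃⁺; `Circle` = SO(2) only
through T5CayleySU11's matrices.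
-/

namespace Summit.Ventures.HodgeRepro2.T5CircleCharacterDetermines

open Summit.Ventures.HodgeRepro2 T5CircleWeights T5CircleWeightSpaces T5HaarCircle
open MeasureTheory Complex

variable {V V' : Type*} [NormedAddCommGroup V] [InnerProductSpace ℂ V] [FiniteDimensional ℂ V]
  [NormedAddCommGroup V'] [InnerProductSpace ℂ V'] [FiniteDimensional ℂ V']
  [MeasurableSpace Circle] [BorelSpace Circle]
  (π : Circle →* V →L[ℂ] V) (π' : Circle →* V' →L[ℂ] V')
  (hπ : Continuous π) (hπ' : Continuous π')

include hπ hπ' in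
/-- Equal characters give equal multiplicities of every integer weight. -/
theorem finrank_weightSpace_eq_of_character_eq
    (h : T5SchurOrthogonality.character π = T5SchurOrthogonality.character π') (n : ℤ) :
    Module.finrank ℂ (T5WeightSpaces.weightSpace π (zpowChar n)) =
      Module.finrank ℂ (T5WeightSpaces.weightSpace π' (zpowChar n)) := by
  have h1 := finrank_weightSpace_zpowChar_eq_integral π hπ haarCircle n
  have h2 := finrank_weightSpace_zpowChar_eq_integral π' hπ' haarCircle n
  rw [h] at h1
  exact_mod_cast h1.trans h2.symm

include hπ hπ' in
/-- THE CHARACTER DETERMINES THE REPRESENTATION: two continuous representations of `Circle` with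
the same character are equivalent, by a linear equivalence intertwining the actions. -/
theorem exists_linearEquiv_of_character_eq
    (h : T5SchurOrthogonality.character π = T5SchurOrthogonality.character π') :
    ∃ e : V ≃ₗ[ℂ] V', ∀ z v, e (π z v) = π' z (e v) := by
  classical
  set A : ℤ → Submodule ℂ V := fun n => T5WeightSpaces.weightSpace π (zpowChar n) with hA
  set A' : ℤ → Submodule ℂ V' := fun n => T5WeightSpaces.weightSpace π' (zpowChar n) with hA'
  have hI : DirectSum.IsInternal A := isInternal_weightSpace_zpowChar π hπ
  have hI' : DirectSum.IsInternal A' := isInternal_weightSpace_zpowChar π' hπ'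
  have hd : ∀ n, Module.finrank ℂ (A n) = Module.finrank ℂ (A' n) :=
    finrank_weightSpace_eq_of_character_eq π π' hπ hπ' h
  -- bases of the weight spaces, indexed by `Fin (dim V_n)` on both sides
  let b : ∀ n, Module.Basis (Fin (Module.finrank ℂ (A n))) ℂ (A n) := fun n =>
    Module.finBasis ℂ (A n)
  let b' : ∀ n, Module.Basis (Fin (Module.finrank ℂ (A n))) ℂ (A' n) := fun n =>
    (Module.finBasis ℂ (A' n)).reindex (finCongr (hd n).symm)
  let B := hI.collectedBasis b
  let B' := hI'.collectedBasis b'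
  refine ⟨B.equiv B' (Equiv.refl _), fun z v => ?_⟩
  -- both sides are linear in `v`; check on the basis `B`
  have key : ((B.equiv B' (Equiv.refl _)).toLinearMap ∘ₗ (π z : V →ₗ[ℂ] V)) =
      ((π' z : V' →ₗ[ℂ] V') ∘ₗ (B.equiv B' (Equiv.refl _)).toLinearMap) := by
    apply B.ext
    intro a
    have hm : B a ∈ A a.1 := hI.collectedBasis_mem b a
    have hm' : B' a ∈ A' a.1 := hI'.collectedBasis_mem b' a
    have e1 : π z (B a) = ((z : ℂ) ^ a.1) • B a := by
      have := (T5WeightSpaces.mem_weightSpace π (zpowChar a.1)).1 hm z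
      simpa [coe_zpowChar_apply] using this
    have e2 : π' z (B' a) = ((z : ℂ) ^ a.1) • B' a := by
      have := (T5WeightSpaces.mem_weightSpace π' (zpowChar a.1)).1 hm' z
      simpa [coe_zpowChar_apply] using this
    simp only [LinearMap.comp_apply, LinearEquiv.coe_coe, ContinuousLinearMap.coe_coe]
    rw [e1, map_smul, Module.Basis.equiv_apply, Equiv.refl_apply, e2]
  exact LinearMap.congr_fun key v

omit [FiniteDimensional ℂ V] [FiniteDimensional ℂ V'] [MeasurableSpace Circle] [BorelSpace Circle] in
/-- The trace is invariant under an intertwining equivalence: equivalent representations have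
the same character. -/
theorem character_eq_of_linearEquiv (e : V ≃ₗ[ℂ] V') (he : ∀ z v, e (π z v) = π' z (e v)) :
    T5SchurOrthogonality.character π = T5SchurOrthogonality.character π' := by
  funext z
  change LinearMap.trace ℂ V (π z : V →ₗ[ℂ] V) = LinearMap.trace ℂ V' (π' z : V' →ₗ[ℂ] V')
  have hconj : (π' z : V' →ₗ[ℂ] V') = e.conj (π z : V →ₗ[ℂ] V) := by
    ext w
    rw [LinearEquiv.conj_apply, LinearMap.comp_apply, LinearMap.comp_apply, LinearEquiv.coe_coe,
      LinearEquiv.coe_coe, ContinuousLinearMap.coe_coe, ContinuousLinearMap.coe_coe, he,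
      LinearEquiv.apply_symm_apply]
  rw [hconj, LinearMap.trace_conj']

include hπ hπ' in
/-- Two continuous representations of `Circle` are equivalent iff they have the same character. -/
theorem exists_linearEquiv_iff_character_eq :
    (∃ e : V ≃ₗ[ℂ] V', ∀ z v, e (π z v) = π' z (e v)) ↔
      T5SchurOrthogonality.character π = T5SchurOrthogonality.character π' :=
  ⟨fun ⟨e, he⟩ => character_eq_of_linearEquiv π π' e he,
    exists_linearEquiv_of_character_eq π π' hπ hπ'⟩

end Summit.Ventures.HodgeRepro2.T5CircleCharacterDetermines
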